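import Summits.QuantumFields.YangMills.Theorems.BalabanUVNodesK0RecordFormatNamesCentred

/-!
# K0⁷ — THE RECORD-SIDE FORMAT NAMES, EDITION 21 = THE ORBIT RECEIPT (C-orb) (★★★ director-ym №542 (iii); ◇ lens-1 g10 finding (2), nodeO STATUS 2026-08-31T09:15:52Z):
# `RootedResponseOrbitAt` (◆ CRIT-1 g36's name, ★★★ №543 (2)) and its centred twin `CentredResponseOrbitAt` — the rooted linearised response lies in the GRADIENT ORBIT of the whole-torus chart-unit window response

Cell `ym-nodeO-ideate` ∕ `ym-balaban-port`, DEFINER seat `ym-nodeO-def-1` (gen 36); `--kind definition --supports stmt-QuantumFields-20541 --as helper`; count-neutral.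
[I] = [Balaban1987RG1], [15] = [Balaban1985Variational], [B6] = [Balaban1984PropagatorsII].

WHY.  Road (R-a) (№541) instantiates JOIN-T's k-step at the leg-dressed rooted chart `recordEmbJDressed … φ′` (ed.20) under the displayed link identity `DressLink … φ′` («`recordGkJ + recordGradLeg (φ′ l a) =
recordGkLocWξ univ`»).  The supplier first booked for that identity, the receipt (C-tab-opt) `K0AxCtabUniq.RootedResponseWeaklyCriticalAt` («the rooted response is [B6]-weakly-critical for the STRAIGHT constraint
`Q_{k+1}` with potential in `N(Q′)`»), was found KILL-SHAPED by ◇ lens-1 g10 (it forces the J5′-forbidden identity `recordHr = recordHrLocξ univ` — the rooted representative would BE the Landau point, contradicting the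
wrap tube; №542 (B)).  What is true-shaped, sufficient for `DressLink`, and what print says ([15] (176)–(178) p.306: the derivative of the minimiser `U_k(V)` is critical for the GAUGE-INVARIANT quadratic form on the
kernel of the linearised (0.4)-constraint `Q_lin`, and `Q_lin ≡ Q_{k+1}` modulo coarse gradients) is the ORBIT statement: the rooted response and the [B6] (2.35) window response `ξ·H e_l·ρ₈(bV a)` differ by the
GRADIENT OF AN UNRESTRICTED site function — no `N(Q′)` clause, no constraint clause.  THIS FILE names it: (C-orb) = `RootedResponseOrbitAt` (◇ lens-1 g10's literal; ◆'s name, ★★★ №543 (2); gradient ORIENTATION `φ(b.tgt) − φ(b.src)` = the tree's `dE 1 φ b`∕`grad 1 φ b`, ✓`dE_eq_gradV1`,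
`LatticeFieldCalculus.grad` :150), and its centred twin.  The bridge `RootedResponseOrbitAt … → DressLink … φ′` is NOT definitional (`DressLink` speaks of `recordGkJ`, the `fderiv` of the two-block
chart — chain rule through `mlog` at `1` under HypAn for the 𝐔-block with `φ′ l a := −sl2Coord ∘ φ`, the current's gauge-blindness for the 𝐉-block): ◇ lens-1 g10 ∕ ▶ PTC-1's kernel port, not this file.
MODEL CHECK (DEF-1 g36 toy, nodeO STATUS 2026-08-31T09:17Z, `ym-nodeO-def-1/g36/toy_w2_L3_M9_v2.out` 5b1b19df): in the d = 2 one-level linearised model the orbit statement holds to 3.3e-11 for the rooted (wrapping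
axial), centred (comb axial) and both Landau-dressed representatives, while the straight-constraint surface (C-tab-opt) presupposes is missed by the rooted objects (|Q·U − ξβ| = 0.139 rooted, 0.0033 centred, 6.7e-13 for
`ξ·hOp`) — numerics, not a proof.

WHAT THIS FILE IS (definitions only; statement-form; NEW names; every earlier object untouched — append-only rule):
* §26f ★ `RootedResponseOrbitAt F θ k K a l : Prop` := `∃ φ : Site (F.P K) 0 → Fin 2 → Fin 2 → ℂ, ∀ b i i', recordD … a l b i i' − recordHrLocξ … Finset.univ a l b i i' = φ b.tgt i i' − φ b.src i i'` — (C-orb),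
  the DISPLAYED supplier of `DressLink`'s 𝐔-block (the port `RootedResponseOrbitAt ∧ HypAn ⟹ DressLink φ′` with `φ′ l a := −sl2Coord ∘ φ`, 𝐉-block by the current's gauge-blindness, is ◇ lens-1∕▶ PTC-1's kernel step).
* §26f `CentredResponseOrbitAt` — the same with ed.18's `recordDC` (the centred comb representative lies in the same orbit; displayed for the parked (R-b) branch and for `stub_LZdet`'s (α) half).

HONEST FRAMING.  Definitions only (two Prop-valued receipts with parameters); NOTHING of Bałaban is asserted, ported or discharged; the receipts are DISPLAYED — asserted for nothing; their inhabitation at the record is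
[15] Prop. 9 ∕ (176)–(178) + [B6] (2.35) content modulo P0's HypAn (without which `recordD` is `fderiv`-junk `0` and the receipt reads «−ξ·H e_l·ρ₈ is a gradient», FALSE — never junk-true); (C-tab-opt) is NOT
rescued here; D1, (Tok-cmpU-cap), HypAn, ⟨26900⟩ OPEN; [E] inhabited unconditionally NOWHERE; 27931 CLOSED·IMPLICATION-ONLY·IN TOTO; 27930 ∕ 26648 OPEN; K0ᴬ ∕ K1ᴬ ∕ K3ᴬ OPEN; NODE O not inhabited (0∕1);
COUNT 8∕28 · K 1∕4 UNMOVED; finite `𝕋⁴_{L^K}` at fixed ε — NOT continuum ∕ ℝ⁴ ∕ OS; **the Yang–Mills mass gap (Clay) is NOT proved by any of this.**  No `sorry`, `instance`, `notation`; standard axioms.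
-/

noncomputable section

open scoped BigOperators Matrix.Norms.L2Operator

namespace Summit.QuantumFields.YangMills.Theorems.K0RecordFormatNames

open Literature.MathematicalPhysics.QuantumFieldTheory.Balaban1983to89
open Literature.MathematicalPhysics.QuantumFieldTheory.Balaban1983to89.Node00
open Literature.MathematicalPhysics.QuantumFieldTheory.Balaban1983to89.T4Continuum (T4Family)

variable (F : T4Family)

section Theta

variable (θ : Stage13Params F 2)

/-! ## §26f  The orbit receipts (C-orb) -/

/-- ★ **RECEIPT (C-orb) `RootedResponseOrbitAt F θ k K a l`** — THE ROOTED LINEARISED RESPONSE LIES IN THE GRADIENT ORBIT OF THE WHOLE-TORUS WINDOW RESPONSE: there is an UNRESTRICTED matrix-valued site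
function `φ` with, entry by entry and bond by bond, `recordD … a l b − recordHrLocξ … Finset.univ a l b = φ(b.tgt) − φ(b.src)` (`recordHrLocξ univ a l b = ξ·windowResp univ l b·ρ₈(bV a)`, ed.16c; ξ = `eta (k+1)`).
Print: [15] (176)–(178) — `U_k(V)′` is critical for the gauge-invariant quadratic form on `ker Q_lin`, `Q_lin ≡ Q_{k+1}` mod coarse gradients, so it shares the gauge ORBIT of the [B6] (2.35) Landau point `H e_l`; the tube
(W-wrap) and the axial roughness ride inside `∇φ`.  No `N(Q′)`-clause, no constraint clause (that is what made (C-tab-opt) kill-shaped).  The displayed SUPPLIER of ed.20's `DressLink` (𝐔-block: `φ′ l a := −sl2Coord ∘ φ`).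
DISPLAYED — asserts nothing; needs P0's HypAn to be about a derivative at all. [cite: Balaban1985Variational, (176)–(178) p.306, Prop. 9 p.309; Balaban1984PropagatorsII, (2.35) p.228, (2.12) p.225; Balaban1987RG1, (4.35) p.290] -/
def RootedResponseOrbitAt (k K : ℕ) (a : θ.ιβ) (l : RespLabel F k K) : Prop :=
  ∃ φ : Site (F.P K) 0 → Fin 2 → Fin 2 → ℂ, ∀ (b : PBond (F.P K) 0) (i i' : Fin 2),
    recordD F θ k K a l b i i' - recordHrLocξ F θ k K Finset.univ a l b i i' = φ b.tgt i i' - φ b.src i i'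

/-- **RECEIPT (C-orb)ᶜ `CentredResponseOrbitAt F θ k K a l`** — the same orbit statement for ed.18's CENTRED comb representative `recordDC` (it differs from `recordD` by the gradient of the linearised comb transporter, so
the two receipts are equivalent modulo that identity; displayed separately for the parked (R-b) branch and `stub_LZdet`'s (α) half).  DISPLAYED — asserts nothing.
[cite: Balaban1985Variational, (176)–(178) p.306, (19) p.281; Balaban1984PropagatorsII, (2.35) p.228; Balaban1987RG1, (2.3) p.265] -/
def CentredResponseOrbitAt (k K : ℕ) (a : θ.ιβ) (l : RespLabel F k K) : Prop :=
  ∃ φ : Site (F.P K) 0 → Fin 2 → Fin 2 → ℂ, ∀ (b : PBond (F.P K) 0) (i i' : Fin 2),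
    recordDC F θ k K a l b i i' - recordHrLocξ F θ k K Finset.univ a l b i i' = φ b.tgt i i' - φ b.src i i'

end Theta

end Summit.QuantumFields.YangMills.Theorems.K0RecordFormatNames

end
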